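import Literature.NumberTheory.EllipticCurves.Kato2004.IwasawaCohomology
import Literature.NumberTheory.GaloisRepresentations.ContinuousCorestrictionComp
import Literature.NumberTheory.GaloisRepresentations.AbsGaloisOuterConj
import Literature.NumberTheory.GaloisRepresentations.AbsIntegersEquiv
import HarnessLib

/-!
# Kato 2004 §8.2: `H¹(O_F[1/p], T)` is stable under corestriction — the case of a NORMAL level
# unramified away from `p` (e.g. `Cor : H¹(ℤ[ζ_{p^{n+1}}, 1/p], T) → H¹(ℤ_n[1/p], T)`), class-level proof

Topic `NumberTheory/EllipticCurves/Kato2004` (about `Kato2004.integralH1` of `IwasawaCohomology.lean`).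
Seat `bsd-potss-rkm` (cell `bsd-potss`, item stmt-BirchSwinnertonDyer-19196): the plumbing lemma W2 of
the zeta-class pin — hypothesis `hint` of `IwasawaH1Data.existsUnique_lift_of_isEulerSystem_of_integral`.

Statement (`coresLe_mem_integralH1`): `V ⊴ Γ_ℚ` normal, open, of finite index in `U ≥ V`, and
containing the inertia groups `I_𝔓` of all primes `𝔓` of `ℤ̄` over rational primes `v ≠ p`
(`SubgroupIsUnramifiedAt ℚ V v`); then `coresLe` maps `integralH1 T p V` into `integralH1 T p U`.
Proof at cocycle level: for `y ∈ U ∩ I_𝔓 ⊆ V`, `y` acts trivially on `U/V` (normality), so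
`(cor_s φ)(y) = Σ_x s(x)·φ(s(x)⁻¹ y s(x))` (`transferCocycle_pullback_apply`); `s(x)⁻¹ y s(x)` lies in
`V ∩ I_{s(x)⁻¹𝔓}` (`Ideal.conj_mem_inertia_smul_iff`, `smul_mem_primesAbove`), where `φ` is a
coboundary by hypothesis, whence `cor_s φ` is a coboundary on `U ∩ I_𝔓` with witness
`Σ_x s(x)·w_x`.  This is the class-level form of the functoriality of `H¹(O_K[S⁻¹], T)` for the trace
(Kato §8.2 "`H^q(R, T)` … étale cohomology", Lemma 8.5; NSW (1.5.7) double coset formula, normal case).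
No new objects, no named facts.

References: K. Kato, Astérisque 295 (2004) §8.2, Lemma 8.5 (pp. 180–184) [Kato2004Asterisque];
J. Neukirch, A. Schmidt, K. Wingberg (2008) I §5 (1.5.7) [NeukirchSchmidtWingberg2008]; tree:
`Kato2004/IwasawaCohomology.lean` (`integralH1`), `GaloisRepresentations/ContinuousCorestrictionComp.lean`
(`transferCocycle_pullback_apply`), `AbsGaloisOuterConj.lean` (`Ideal.conj_mem_inertia_smul_iff`),
`AbsIntegersEquiv.lean` (`smul_mem_primesAbove`).
-/

noncomputable section

open scoped NumberField Pointwise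
open CategoryTheory Field IsDedekindDomain
open Literature.NumberTheory.GaloisRepresentations Rat.HeightOneSpectrum
open Literature.NumberTheory.EllipticCurves (schreierElt schreierElt_mem schreierElt_coe
  rep_mul_schreierElt subgroupInclusion subgroupInclusion_apply_coe)

namespace Literature.NumberTheory.EllipticCurves.Kato2004

variable {A : Type} [CommRing A] [TopologicalSpace A] {M : Type} [AddCommGroup M] [Module A M]
  [TopologicalSpace M] [IsTopologicalAddGroup M] [ContinuousSMul A M]

/-- For `N` normal, elements of `N` act trivially on `U/N`. [folklore] -/
private theorem smul_eq_self_of_mem' {G : Type*} [Group G] {N U : Subgroup G} [N.Normal] {n : U}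
    (hn : (n : G) ∈ N) (x : U ⧸ N.subgroupOf U) : n • x = x := by
  induction x using QuotientGroup.induction_on with
  | H u =>
    rw [MulAction.Quotient.smul_mk, QuotientGroup.eq, Subgroup.mem_subgroupOf, smul_eq_mul]
    have : (((n * u)⁻¹ * u : U) : G) = (u : G)⁻¹ * (n : G)⁻¹ * ((u : G)⁻¹)⁻¹ := by
      push_cast; group
    rw [this]
    exact Subgroup.Normal.conj_mem inferInstance _ (N.inv_mem hn) _

/-- **Corestriction preserves the integral classes (normal unramified case).**  Let `V ⊴ Γ_ℚ` be a
normal open subgroup of finite index in `U ≥ V` such that `V` CONTAINS THE INERTIA GROUPS at every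
rational prime `v ≠ p` (e.g. `V = Gal(ℚ̄/ℚ(μ_{p^{n+1}}))`, unramified away from `p`).  Then
`Cor_{V→U}` maps `H¹(ℤ_V[1/p], T) = integralH1 T p V` into `H¹(ℤ_U[1/p], T) = integralH1 T p U`:
for `𝔓 ∣ v ≠ p`, `I_𝔓 ≤ V` and `(cor_s φ)(y) = Σ_x s(x)·φ(s(x)⁻¹ y s(x))` for `y ∈ I_𝔓` (`y` acts
trivially on `U/V`), where `s(x)⁻¹ y s(x) ∈ I_{s(x)⁻¹𝔓}` and `φ` is a coboundary on each `V ∩ I_{𝔓'}`,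
`𝔓' ∣ v` — so `cor_s φ` is a coboundary on `U ∩ I_𝔓` (Kato §8.2: `H¹(O_K[S⁻¹], T)` is functorial for
the trace along `O_L[S⁻¹]/O_K[S⁻¹]`; NSW (1.5.7)). [cite: Kato2004Asterisque, §8.2 and Lemma 8.5 (pp. 180–184)] -/
theorem coresLe_mem_integralH1 (T : GaloisRep ℚ A M) (p : ℕ)
    {V U : Subgroup (absoluteGaloisGroup ℚ)} [V.Normal] (h : V ≤ U)
    (hV : IsOpen (V : Set (absoluteGaloisGroup ℚ))) [Fintype (U ⧸ V.subgroupOf U)]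
    (hunr : ∀ v : HeightOneSpectrum (𝓞 ℚ), ((primesEquiv v : Nat.Primes) : ℕ) ≠ p →
      SubgroupIsUnramifiedAt ℚ V v)
    {x : H1 T V} (hx : x ∈ integralH1 T p V) :
    coresLe T.toTopRep h hV x ∈ integralH1 T p U := by
  rw [mem_integralH1_iff] at hx ⊢
  intro v hv 𝔓 h𝔓
  obtain ⟨φ, rfl⟩ := oneCocycleClass_surjective _ x
  -- representatives of `U/V`
  have hs : ∀ y : U ⧸ V.subgroupOf U, ((Quotient.out y : U) : U ⧸ V.subgroupOf U) = y :=
    fun y ↦ QuotientGroup.out_eq' y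
  -- `φ` is a coboundary on `V ∩ I_{𝔓'}` for every `𝔓' ∣ v`: choose the witnesses at the conjugates
  have hcob : ∀ y : U ⧸ V.subgroupOf U, ∃ w : M,
      ∀ g : ↥(V ⊓ ((((Quotient.out y : U) : absoluteGaloisGroup ℚ)⁻¹ • 𝔓).inertia
        (absoluteGaloisGroup ℚ))),
      φ.1 (subgroupInclusion inf_le_left g) = T.toTopRep.ρ (g : absoluteGaloisGroup ℚ) w - w := by
    intro y
    have h0 := hx v hv _ (smul_mem_primesAbove h𝔓 ((Quotient.out y : U) : absoluteGaloisGroup ℚ)⁻¹)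
    rw [resLe_oneCocycleClass, oneCocycleClass_eq_zero_iff] at h0
    obtain ⟨w, hw⟩ := h0
    exact ⟨w, fun g ↦ hw g⟩
  choose w hw using hcob
  rw [coresLe_oneCocycleClass T.toTopRep h hV hs φ, resLe_oneCocycleClass, oneCocycleClass_eq_zero_iff]
  refine ⟨∑ y, T.toTopRep.ρ ((Quotient.out y : U) : absoluteGaloisGroup ℚ) (w y), fun g ↦ ?_⟩
  -- `g ∈ U ∩ I_𝔓`, hence `g ∈ V` (unramified) and it acts trivially on `U/V`
  have hgI : (g : absoluteGaloisGroup ℚ) ∈ 𝔓.inertia (absoluteGaloisGroup ℚ) := g.2.2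
  have hgV : (g : absoluteGaloisGroup ℚ) ∈ V := hunr v hv 𝔓 h𝔓 hgI
  rw [contOneCocycles.pullback_apply, TopRep.hom_ofHom]
  change (transferCocycle (subgroupRep T.toTopRep U) (V.subgroupOf U) (isOpen_subgroupOf U hV) hs
      (contOneCocycles.pullback (subgroupOfHom h)
        (Y := subgroupRep (subgroupRep T.toTopRep U) (V.subgroupOf U))
        (TopRep.ofHom ⟨ContinuousLinearMap.id A M, fun _ => rfl⟩) φ)).1
      (subgroupInclusion (inf_le_left : U ⊓ 𝔓.inertia (absoluteGaloisGroup ℚ) ≤ U) g) = _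
  rw [transferCocycle_pullback_apply T.toTopRep h hV hs, map_sum, ← Finset.sum_sub_distrib]
  refine Finset.sum_congr rfl fun y _ ↦ ?_
  have hgy : subgroupInclusion (inf_le_left : U ⊓ 𝔓.inertia (absoluteGaloisGroup ℚ) ≤ U) g • y = y :=
    smul_eq_self_of_mem' (by simpa [subgroupInclusion_apply_coe] using hgV) y
  -- the Schreier element `s(y)⁻¹ g s(y)` lies in `V ∩ I_{s(y)⁻¹ 𝔓}`
  set σ : absoluteGaloisGroup ℚ := ((Quotient.out y : U) : absoluteGaloisGroup ℚ) with hσ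
  have hmemI : σ⁻¹ * (g : absoluteGaloisGroup ℚ) * σ ∈ (σ⁻¹ • 𝔓).inertia (absoluteGaloisGroup ℚ) := by
    have := (Ideal.conj_mem_inertia_smul_iff 𝔓 σ⁻¹ (g : absoluteGaloisGroup ℚ)).mpr hgI
    simpa using this
  have hmemV : σ⁻¹ * (g : absoluteGaloisGroup ℚ) * σ ∈ V :=
    Subgroup.Normal.conj_mem' inferInstance _ hgV σ
  have key := hw y ⟨σ⁻¹ * (g : absoluteGaloisGroup ℚ) * σ, hmemV, hmemI⟩
  -- identify the argument of `φ`
  have harg : subgroupOfHom h (schreierElt (V.subgroupOf U) hs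
        (subgroupInclusion (inf_le_left : U ⊓ 𝔓.inertia (absoluteGaloisGroup ℚ) ≤ U) g) y) =
      subgroupInclusion inf_le_left ⟨σ⁻¹ * (g : absoluteGaloisGroup ℚ) * σ, hmemV, hmemI⟩ := by
    apply Subtype.ext
    rw [subgroupOfHom_apply_coe, schreierElt_coe, hgy, subgroupInclusion_apply_coe]
    simp [hσ, subgroupInclusion_apply_coe]
  have key' : φ.1 (subgroupInclusion inf_le_left ⟨σ⁻¹ * (g : absoluteGaloisGroup ℚ) * σ, hmemV, hmemI⟩) =
      T.toTopRep.ρ (σ⁻¹ * (g : absoluteGaloisGroup ℚ) * σ) (w y) - w y := key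
  rw [hgy, harg, key', map_sub, subgroupRep_ρ_apply, ← ρ_mul_apply, ← ρ_mul_apply, ← hσ]
  have hprod : σ * (σ⁻¹ * (g : absoluteGaloisGroup ℚ) * σ) = (g : absoluteGaloisGroup ℚ) * σ := by
    group
  rw [hprod]

end Literature.NumberTheory.EllipticCurves.Kato2004

end
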